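import Mathlib.Tactic.Ring
import Mathlib.Tactic.Linarith
import Mathlib.Tactic.LinearCombination
import Mathlib.Tactic.NormNum
import Mathlib.Data.Real.Basic
import Mathlib.Analysis.Real.Sqrt
import HarnessLib

/-!
# Conjecture N in format (4,2): THE SHARP CONSTANT IS ATTAINED (hodge-weil ladder, GAPS G51b′ / G51c)

Prover 2, generation 14 (note `run/shared/lean/b2b/hodge-weil/b2b-hweil-pv2-g14/THREE-PHASE-G14.md`). Companion of
`WeilClassTestFormatFourTwoLambda.conjectureN_42_sharp` (`Q₂ + (3 + 2√3)·Q₄ ≥ 0` for every centred, pure, pairwise-ample real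
(4,2) configuration): the bound is an EQUALITY at pv2-g9's (4,2) cross maximiser (`CONJECTURE-N.md` §4c, there verified in exact
`ℚ(√3)` arithmetic by `code/pv2-g9/q3check.py`; here in the kernel). The configuration (centred coordinates): E-roots
`(A; u) = (−2 + √3/3; −1/2 + 5√3/6), (1 − √3; 1/2 − √3/2) (twice), (−√3; 3/2 − √3/2)`, F-roots
`(B; v) = (−1/2 − 7√3/6; 1 − 2√3/3), (1/2 − 3√3/2; 1)`: charge pattern `E E F₁ E E F₂` (`u₂ = u₃ < v₁ < u₄ < u₁ < v₂`; `F₂`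
above all E-charges — the reflected one-sided case of `WeilClassTestFormatFourTwoSlopes.one_sided_lambda`): from `F₂` the absolute
inverse slopes `|A_e − B₂|/|u_e − v₂|` are `(5+4√3, 1, 1, 1)` (`E₂, E₃, E₄` on the lower null ray of `F₂`), from `F₁` they are
`(1, 5+2√3, 5+2√3, 1)` (`E₁, E₄` on the upper null ray of `F₁`); `e₁ = 8 + 4√3`, `e₂ = 18 + 12√3` — the equality case of the
slope lemma —, `Q₂ = 3`, `Q₄ = 3 − 2√3`, so `−Q₄/Q₂ = 2/√3 − 1` and `Q₂ + (3+2√3)Q₄ = 0`.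
THEOREM (`conjectureN_42_sharp_attained`): this configuration satisfies every hypothesis of `conjectureN_42_lambda` and the
equality; hence `sup −Q₄/Q₂ = 2/√3 − 1` over centred pure pairwise-ample real (4,2) configurations with `Q₂ > 0` (pv2-g9 §4,
pv2-g13 §0: `sup R′`) is a theorem, attained. Pure arithmetic in `ℚ(√3)` (`(√3)² = 3`, `17/10 < √3 < 7/4`). Nothing here is a
case of HC, a rung or a door edge (C22); no statement of Markman's papers is used. New cell result ⇒ Summits/.
-/

set_option linter.dupNamespace false

namespace Summit.HodgeConjecture.HodgeConjecture.WeilClassTestFormatFourTwoLambda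

/-- **THE SHARP CONSTANT `3 + 2√3` IS ATTAINED**: an explicit centred, pure, pairwise-ample real (4,2) configuration (pv2-g9's cross
maximiser, exact in `ℚ(√3)`) with `Q₂ + (3 + 2√3)·Q₄ = 0` and `Q₂ = 3 > 0` (so `−Q₄/Q₂ = 2/√3 − 1`). -/
theorem conjectureN_42_sharp_attained :
    ∃ A₁ A₂ A₃ A₄ B₁ B₂ u₁ u₂ u₃ u₄ v₁ v₂ : ℝ,
      A₁ + A₂ + A₃ + A₄ = B₁ + B₂ ∧
      u₁ + u₂ + u₃ + u₄ = v₁ + v₂ ∧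
      (A₁ ^ 2 * u₁ + A₂ ^ 2 * u₂ + A₃ ^ 2 * u₃ + A₄ ^ 2 * u₄) - (B₁ ^ 2 * v₁ + B₂ ^ 2 * v₂) = 0 ∧
      (A₁ * u₁ ^ 2 + A₂ * u₂ ^ 2 + A₃ * u₃ ^ 2 + A₄ * u₄ ^ 2) - (B₁ * v₁ ^ 2 + B₂ * v₂ ^ 2) = 0 ∧
      (u₁ ^ 3 + u₂ ^ 3 + u₃ ^ 3 + u₄ ^ 3) - (v₁ ^ 3 + v₂ ^ 3) = 0 ∧
      |u₁ - v₁| ≤ A₁ - B₁ ∧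
      |u₂ - v₁| ≤ A₂ - B₁ ∧
      |u₃ - v₁| ≤ A₃ - B₁ ∧
      |u₄ - v₁| ≤ A₄ - B₁ ∧
      |u₁ - v₂| ≤ A₁ - B₂ ∧
      |u₂ - v₂| ≤ A₂ - B₂ ∧
      |u₃ - v₂| ≤ A₃ - B₂ ∧
      |u₄ - v₂| ≤ A₄ - B₂ ∧
      (1 / 2) * ((A₁ ^ 2 + A₂ ^ 2 + A₃ ^ 2 + A₄ ^ 2) - (B₁ ^ 2 + B₂ ^ 2)) * ((u₁ ^ 2 + u₂ ^ 2 + u₃ ^ 2 + u₄ ^ 2) - (v₁ ^ 2 + v₂ ^ 2))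
        + ((A₁ * u₁ + A₂ * u₂ + A₃ * u₃ + A₄ * u₄) - (B₁ * v₁ + B₂ * v₂)) ^ 2
        - 3 * ((A₁ ^ 2 * u₁ ^ 2 + A₂ ^ 2 * u₂ ^ 2 + A₃ ^ 2 * u₃ ^ 2 + A₄ ^ 2 * u₄ ^ 2) - (B₁ ^ 2 * v₁ ^ 2 + B₂ ^ 2 * v₂ ^ 2))
        + (3 + 2 * Real.sqrt 3) * (3 * ((u₁ ^ 4 + u₂ ^ 4 + u₃ ^ 4 + u₄ ^ 4) - (v₁ ^ 4 + v₂ ^ 4)) - (3 / 2) * ((u₁ ^ 2 + u₂ ^ 2 + u₃ ^ 2 + u₄ ^ 2) - (v₁ ^ 2 + v₂ ^ 2)) ^ 2) = 0 ∧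
      0 < (1 / 2) * ((A₁ ^ 2 + A₂ ^ 2 + A₃ ^ 2 + A₄ ^ 2) - (B₁ ^ 2 + B₂ ^ 2)) * ((u₁ ^ 2 + u₂ ^ 2 + u₃ ^ 2 + u₄ ^ 2) - (v₁ ^ 2 + v₂ ^ 2))
        + ((A₁ * u₁ + A₂ * u₂ + A₃ * u₃ + A₄ * u₄) - (B₁ * v₁ + B₂ * v₂)) ^ 2
        - 3 * ((A₁ ^ 2 * u₁ ^ 2 + A₂ ^ 2 * u₂ ^ 2 + A₃ ^ 2 * u₃ ^ 2 + A₄ ^ 2 * u₄ ^ 2) - (B₁ ^ 2 * v₁ ^ 2 + B₂ ^ 2 * v₂ ^ 2)) := by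
  have h3 : Real.sqrt 3 ^ 2 = 3 := Real.sq_sqrt (by norm_num)
  have hlo : (17 / 10 : ℝ) < Real.sqrt 3 := (Real.lt_sqrt (by norm_num)).2 (by norm_num)
  have hhi : Real.sqrt 3 < (7 / 4 : ℝ) := (Real.sqrt_lt' (by norm_num)).2 (by norm_num)
  refine ⟨((-2 : ℝ) + (1 / 3 : ℝ) * Real.sqrt 3), ((1 : ℝ) + (-1 : ℝ) * Real.sqrt 3), ((1 : ℝ) + (-1 : ℝ) * Real.sqrt 3), ((-1 : ℝ) * Real.sqrt 3), ((-1 / 2 : ℝ) + (-7 / 6 : ℝ) * Real.sqrt 3), ((1 / 2 : ℝ) + (-3 / 2 : ℝ) * Real.sqrt 3), ((-1 / 2 : ℝ) + (5 / 6 : ℝ) * Real.sqrt 3), ((1 / 2 : ℝ) + (-1 / 2 : ℝ) * Real.sqrt 3), ((1 / 2 : ℝ) + (-1 / 2 : ℝ) * Real.sqrt 3), ((3 / 2 : ℝ) + (-1 / 2 : ℝ) * Real.sqrt 3), ((1 : ℝ) + (-2 / 3 : ℝ) * Real.sqrt 3), (1 : ℝ),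
    by ring, by ring, ?_, ?_, ?_, ?_, ?_, ?_, ?_, ?_, ?_, ?_, ?_, ?_, ?_⟩
  · linear_combination ((1 / 2 : ℝ) + (-1 / 2 : ℝ) * Real.sqrt 3) * h3
  · linear_combination (0) * h3
  · linear_combination ((-1 / 2 : ℝ) + (1 / 2 : ℝ) * Real.sqrt 3) * h3
  · exact abs_le.2 ⟨by linarith, by linarith⟩
  · exact abs_le.2 ⟨by linarith, by linarith⟩
  · exact abs_le.2 ⟨by linarith, by linarith⟩
  · exact abs_le.2 ⟨by linarith, by linarith⟩
  · exact abs_le.2 ⟨by linarith, by linarith⟩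
  · exact abs_le.2 ⟨by linarith, by linarith⟩
  · exact abs_le.2 ⟨by linarith, by linarith⟩
  · exact abs_le.2 ⟨by linarith, by linarith⟩
  · linear_combination ((-19 / 2 : ℝ) + (31 / 6 : ℝ) * Real.sqrt 3 + (9 / 2 : ℝ) * Real.sqrt 3 ^ 2 + (-1 / 6 : ℝ) * Real.sqrt 3 ^ 3) * h3
  · have e : (1 / 2) * (((((-2 : ℝ) + (1 / 3 : ℝ) * Real.sqrt 3)) ^ 2 + (((1 : ℝ) + (-1 : ℝ) * Real.sqrt 3)) ^ 2 + (((1 : ℝ) + (-1 : ℝ) * Real.sqrt 3)) ^ 2 + (((-1 : ℝ) * Real.sqrt 3)) ^ 2) - ((((-1 / 2 : ℝ) + (-7 / 6 : ℝ) * Real.sqrt 3)) ^ 2 + (((1 / 2 : ℝ) + (-3 / 2 : ℝ) * Real.sqrt 3)) ^ 2)) * (((((-1 / 2 : ℝ) + (5 / 6 : ℝ) * Real.sqrt 3)) ^ 2 + (((1 / 2 : ℝ) + (-1 / 2 : ℝ) * Real.sqrt 3)) ^ 2 + (((1 / 2 : ℝ) + (-1 / 2 : ℝ) * Real.sqrt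 3)) ^ 2 + (((3 / 2 : ℝ) + (-1 / 2 : ℝ) * Real.sqrt 3)) ^ 2) - ((((1 : ℝ) + (-2 / 3 : ℝ) * Real.sqrt 3)) ^ 2 + ((1 : ℝ)) ^ 2))
        + (((((-2 : ℝ) + (1 / 3 : ℝ) * Real.sqrt 3)) * (((-1 / 2 : ℝ) + (5 / 6 : ℝ) * Real.sqrt 3)) + (((1 : ℝ) + (-1 : ℝ) * Real.sqrt 3)) * (((1 / 2 : ℝ) + (-1 / 2 : ℝ) * Real.sqrt 3)) + (((1 : ℝ) + (-1 : ℝ) * Real.sqrt 3)) * (((1 / 2 : ℝ) + (-1 / 2 : ℝ) * Real.sqrt 3)) + (((-1 : ℝ) * Real.sqrt 3)) * (((3 / 2 : ℝ) + (-1 / 2 : ℝ) * Real.sqrt 3))) - ((((-1 / 2 : ℝ) + (-7 / 6 : ℝ) * Real.sqrt 3)) * (((1 : ℝ) + (-2 / 3 : ℝ) * Real.sqrt 3)) + (((1 / 2 : ℝ) + (-3 / 2 : ℝ) * Real.sqrt 3)) * ((1 : ℝ)))) ^ 2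
        - 3 * (((((-2 : ℝ) + (1 / 3 : ℝ) * Real.sqrt 3)) ^ 2 * (((-1 / 2 : ℝ) + (5 / 6 : ℝ) * Real.sqrt 3)) ^ 2 + (((1 : ℝ) + (-1 : ℝ) * Real.sqrt 3)) ^ 2 * (((1 / 2 : ℝ) + (-1 / 2 : ℝ) * Real.sqrt 3)) ^ 2 + (((1 : ℝ) + (-1 : ℝ) * Real.sqrt 3)) ^ 2 * (((1 / 2 : ℝ) + (-1 / 2 : ℝ) * Real.sqrt 3)) ^ 2 + (((-1 : ℝ) * Real.sqrt 3)) ^ 2 * (((3 / 2 : ℝ) + (-1 / 2 : ℝ) * Real.sqrt 3)) ^ 2) - ((((-1 / 2 : ℝ) + (-7 / 6 : ℝ) * Real.sqrt 3)) ^ 2 * (((1 : ℝ) + (-2 / 3 : ℝ) * Real.sqrt 3)) ^ 2 + (((1 / 2 : ℝ) + (-3 / 2 : ℝ) * Real.sqrt 3)) ^ 2 * ((1 : ℝ)) ^ 2)) = 3 := by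
      linear_combination ((-1 / 4 : ℝ) + (5 / 3 : ℝ) * Real.sqrt 3 + (1 / 12 : ℝ) * Real.sqrt 3 ^ 2) * h3
    rw [e]; norm_num

end Summit.HodgeConjecture.HodgeConjecture.WeilClassTestFormatFourTwoLambda
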